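/-
Copyright: literature anchor, engines group (eng-cap-1, gen 139). Typed from the held text; see the
module docstring for sources and scope.
-/
import Mathlib
import Literature.Combinatorics.Hinz2018.IrregularToRegularMixedGraph
import Literature.Combinatorics.Hinz2018.IrregularToRegularMixedGraphDegrees

/-!
# Hinz–Klavžar–Petr, *The Tower of Hanoi* (2018), Ch. 3 §3.1, pp. 166–167: the mixed graph
# `\vec H_3^n` COUNTED for every `n ≥ 1` — arcs `3·|𝔗^n| − 3·n!`, one-peg states `3·n!`,
# EDGES = STATES (`(n+2)!` reversible arcs, i.e. `|𝔗^n| = (n+2)!/2` edges), one-way arcs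
# `|𝔗^n| − 3·n!`

[cite: HinzKlavzarPetr2018, Ch. 3 §3.1 pp. 166–167 (the mixed graph \vec H_3^n; Figure 3.2)]

A. M. Hinz, S. Klavžar, C. Petr, *The Tower of Hanoi — Myths and Maths*, 2nd ed., Birkhäuser
2018 (held: `book:hinz2018-tower-hanoi-myths-maths`; chunk `p0156` of the held text holds the
printed p. 166, chunk `p0157` the caption of Figure 3.2 on p. 167).

THE SPAN (chunk p0156 l.7, read whole). The digraph `\vec H_3^n` on the states `𝔗^n` has an arc
`(σ, τ)` when `τ` results from `σ` «by a legal move of one disc»; «some of the edges must be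
oriented»; when both arcs `(σ, τ)` and `(τ, σ)` are present «it is customary to identify them
with an edge», which makes `\vec H_3^n` a mixed graph, «that is a graph containing both edges
and arcs». Figure 3.2 (p. 167) draws `\vec H_3^2` and `\vec H_3^3`, «so that the mixed graph
contains 60 vertices» for `n = 3` (Proposition 3.1, `|𝔗^n| = (n+2)!/2`). The book gives no
closed count of the arcs or of the edges of `\vec H_3^n`; the counts below are OURS, read off the
book's definitions, and agree with the kernel censuses of the siblings for `n = 2, 3, 4`
(`IrregularToRegular.figure_3_2_arcs`: 30 arcs, 24 reversible; `IrregularMixedGraphCensus`: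
162 / 120 / 42 and 1008 / 720 / 288 arcs / reversible / one-way, 18 and 72 one-peg states).

THE TREE BEFORE THIS FILE (used BY NAME, nothing restated). `IrregularToRegular.lean`: `IState`,
`IsState n`, the legal move `step σ (p, q)` (`step_inv`, `step_of_stack`, `ne_of_step_eq_some`,
`perm_discs_of_step`, `discs_perm_stack_rest`, `eq_add_of_ne`, `IsState.peg_unique`), the third
peg `-(p+q)` (`third_ne`, `eq_third`), the six moves `movePairs` (`mem_movePairs`), the arcs
`Arc σ τ` / out-neighbours `succs σ = movePairs.filterMap (step σ)` (`mem_succs`), the enumeration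
`allStates n` of `𝔗^n` by strings and bars (`barPairs`, `mem_barPairs`, `nodup_barPairs`,
`ofString`, `mem_allStates`, `nodup_allStates`, `length_allStates` = Proposition 3.1).
`IrregularToRegularMixedGraph.lean` (`arc_reverse_iff`, `exists_oneWay_arc`): the edge criterion
`step_reverse_iff` (the arc of the move of the top disc `x` of peg `p`, rest `l`, is half of an
edge iff `∀ y ∈ l.head?, x < y`) and `move_eq_of_step_of_step` (the only way back is the reversed
move). `IrregularToRegularMixedGraphDegrees.lean`: `length_succs_of_isState` (out-degree 2 on the
one-peg states of `𝔗^n`, 3 on the others, `n ≠ 0`).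

WHAT THIS FILE TYPES (18 theorems, all proved, every `n ≠ 0`; statements and proofs OURS):
* ONE-PEG STATES: `length_filter_onePeg_allStates` — the states of `allStates n` with two empty
  pegs number `3·n!` (per string of the `n` discs exactly the bar positions `(0,0)`, `(0,n)`,
  `(n,n)`: `filter_barPairs_onePeg`);
* ARCS: `sum_length_succs_allStates_add` — summing `length_succs_of_isState` over `𝔗^n`:
  `Σ_σ |succs σ| + 3·n! = 3·|𝔗^n|`; closed form `sum_length_succs_allStates`:
  `3·((n+2)!/2) − 3·n!` (162 for `n = 3`, 1008 for `n = 4`);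
* EDGES = STATES: `sum_length_filter_reversible_allStates` — the reversible arcs (those `τ ∈
  succs σ` with `σ ∈ succs τ`) number `2·|𝔗^n|`, closed form `(n+2)!`
  (`sum_length_filter_reversible_allStates_eq_factorial`; 24, 120, 720 for `n = 2, 3, 4`): the
  mixed graph `\vec H_3^n` has exactly as many edges as vertices. THE BIJECTION (ours): a
  reversible arc moves the top disc `x` of peg `p` onto peg `q` where `x` can come back, i.e. the
  tops of `q` and of `p` below `x` are larger than `x` or absent; PARK `x` on the third peg
  `-(p+q)` instead (legal or not): in the parked state `x` is the top disc that moves legally to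
  BOTH other pegs (`park_of_reversible`), and such a peg exists in every nonempty state of `𝔗^n`
  — the peg of the smallest top disc (`exists_peg_twoLegal`) — and is unique
  (`peg_twoLegal_unique`), so exactly two of the six moves start there
  (`length_filter_twoLegal_movePairs`); conversely moving that disc to either other peg yields a
  reversible arc towards the remaining peg (`reversible_of_twoLegal`); parking and unparking are
  mutually inverse (`unpark_park`), whence reversible arcs `≃` states `×` 2
  (`Finset.card_nbij'`). Reversible arcs out of one state are counted by moves
  (`length_filter_reversible_eq`, via `move_eq_of_step_of_step`);
* ONE-WAY ARCS: `sum_length_filter_oneWay_allStates_add` — `Σ + 3·n! = |𝔗^n|`, closed form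
  `sum_length_filter_oneWay_allStates`: `(n+2)!/2 − 3·n!` (6, 42, 288 for `n = 2, 3, 4`);
* tools: `nodup_movePairs`, `ne_of_mem_movePairs`, `perm_discs_park` (parking permutes the
  discs); from Mathlib `Finset.exists_min_image`, `Finset.card_nbij'`, `Finset.card_filter`,
  `Option.bind_eq_some_iff`, `List.sum_toFinset`.

NOT TYPED: Figure 3.2 as a drawing; the number of edges of the undirected graph underlying
`\vec H_3^n` with the one-way arcs forgotten (`|𝔗^n| + (|𝔗^n| − 3·n!)`, a corollary not stated in
the book either); mixed graphs as a Mathlib structure (an edge stays a pair of opposite arcs of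
the relation `Arc` / the list `succs`). D-0026: no `def`, no named fact introduced or discharged
(delta 0).
-/

namespace Literature.Combinatorics.Hinz2018

namespace IrregularMixedGraphCounts

open IrregularToRegular IrregularMixedGraph IrregularMixedGraphDegrees

/-! ## One-peg states and arcs -/

/-- For a string `w` of `n ≠ 0` discs exactly three positions of the two bars put all discs on
one peg: `(0,0)`, `(0,n)` and `(n,n)` (the enumeration of Proposition 3.1).
[cite: HinzKlavzarPetr2018, Ch. 3 §3.1 pp. 165–166 (states as strings with bars; Prop. 3.1)] -/
theorem filter_barPairs_onePeg {n : ℕ} (hn : n ≠ 0) {w : List ℕ} (hw : w.length = n) :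
    ((barPairs n).filter fun ij =>
      decide (((ofString w ij).p1 = [] ∧ (ofString w ij).p2 = []) ∨
        ((ofString w ij).p0 = [] ∧ (ofString w ij).p2 = []) ∨
        ((ofString w ij).p0 = [] ∧ (ofString w ij).p1 = []))).length = 3 := by
  have hw' : w ≠ [] := by
    rintro rfl
    exact hn (by simpa using hw.symm)
  rw [← List.toFinset_card_of_nodup ((nodup_barPairs n).filter _)]
  have : ((barPairs n).filter fun ij =>
      decide (((ofString w ij).p1 = [] ∧ (ofString w ij).p2 = []) ∨
        ((ofString w ij).p0 = [] ∧ (ofString w ij).p2 = []) ∨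
        ((ofString w ij).p0 = [] ∧ (ofString w ij).p1 = []))).toFinset =
      {(0, 0), (0, n), (n, n)} := by
    ext ⟨i, j⟩
    simp only [List.mem_toFinset, List.mem_filter, mem_barPairs, decide_eq_true_eq, ofString,
      List.take_eq_nil_iff, List.drop_eq_nil_iff, hw, hw', or_false, Finset.mem_insert,
      Finset.mem_singleton, Prod.mk.injEq]
    omega
  rw [this, Finset.card_eq_three]
  exact ⟨(0, 0), (0, n), (n, n), by simp [hn.symm], by simp [hn.symm], by simp [hn.symm], rfl⟩

/-- ONE-PEG STATES: the states of `𝔗^n`, `n ≠ 0`, with all discs on one peg number `3·n!` (a peg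
and an arbitrary stacking of the `n` discs; Figure 3.2: 18 of the 60 states of `𝔗^3`).
[cite: HinzKlavzarPetr2018, Ch. 3 §3.1 pp. 166–167 (Prop. 3.1; Figure 3.2; count ours)] -/
theorem length_filter_onePeg_allStates {n : ℕ} (hn : n ≠ 0) :
    ((allStates n).filter fun σ =>
      (σ.p1 = [] ∧ σ.p2 = []) ∨ (σ.p0 = [] ∧ σ.p2 = []) ∨ (σ.p0 = [] ∧ σ.p1 = [])).length =
      3 * Nat.factorial n := by
  rw [allStates, List.filter_flatMap, List.length_flatMap]
  have hperm : ∀ w ∈ (List.range' 1 n).permutations', w.length = n := fun w hw => by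
    rw [List.mem_permutations'] at hw; rw [hw.length_eq, List.length_range']
  have : ((List.range' 1 n).permutations'.map fun w => (((barPairs n).map (ofString w)).filter
      fun σ => decide ((σ.p1 = [] ∧ σ.p2 = []) ∨ (σ.p0 = [] ∧ σ.p2 = []) ∨
        (σ.p0 = [] ∧ σ.p1 = []))).length) =
      (List.range' 1 n).permutations'.map fun _ => 3 := by
    apply List.map_congr_left
    intro w hw
    rw [List.filter_map, List.length_map]
    exact filter_barPairs_onePeg hn (hperm w hw)
  rw [this, List.map_const', List.sum_replicate, smul_eq_mul,
    ← (List.permutations_perm_permutations' (List.range' 1 n)).length_eq,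
    List.length_permutations, List.length_range', Nat.mul_comm]

/-- ARCS: summing the out-degrees of `\vec H_3^n` over `𝔗^n`, `n ≠ 0` — 2 on the `3·n!` one-peg
states, 3 on the others —: `Σ_σ |succs σ| + 3·n! = 3·|𝔗^n|`.
[cite: HinzKlavzarPetr2018, Ch. 3 §3.1 pp. 166–167 (arcs of \vec H_3^n; Figure 3.2; ours)] -/
theorem sum_length_succs_allStates_add {n : ℕ} (hn : n ≠ 0) :
    ((allStates n).map fun σ => (succs σ).length).sum + 3 * Nat.factorial n =
      3 * (allStates n).length := by
  have key : ∀ (P : IState → Prop) [DecidablePred P] (l : List IState),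
      (l.map fun σ => if P σ then 1 else 0).sum = (l.filter fun σ => decide (P σ)).length := by
    intro P _ l
    induction l with
    | nil => simp
    | cons a l ih => by_cases h : P a <;> simp [h, ih, Nat.add_comm]
  rw [← length_filter_onePeg_allStates hn, ← key, ← List.sum_map_add]
  have : ((allStates n).map fun σ => (succs σ).length +
      if (σ.p1 = [] ∧ σ.p2 = []) ∨ (σ.p0 = [] ∧ σ.p2 = []) ∨ (σ.p0 = [] ∧ σ.p1 = [])
      then 1 else 0) = (allStates n).map fun _ => 3 := by
    apply List.map_congr_left
    intro σ hσ
    rw [length_succs_of_isState (mem_allStates.1 hσ) hn]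
    split_ifs <;> rfl
  rw [this, List.map_const', List.sum_replicate, smul_eq_mul, Nat.mul_comm]

/-- ARCS in closed form: `\vec H_3^n`, `n ≠ 0`, has `3·(n+2)!/2 − 3·n!` arcs (30 for `n = 2`,
162 for `n = 3`, 1008 for `n = 4`).
[cite: HinzKlavzarPetr2018, Ch. 3 §3.1 pp. 166–167 (arcs of \vec H_3^n; Figure 3.2; ours)] -/
theorem sum_length_succs_allStates {n : ℕ} (hn : n ≠ 0) :
    ((allStates n).map fun σ => (succs σ).length).sum =
      3 * ((n + 2).factorial / 2) - 3 * Nat.factorial n := by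
  have h := sum_length_succs_allStates_add hn
  rw [length_allStates] at h
  omega

/-! ## Edges = states: tools -/

/-- The six moves are distinct.
[cite: HinzKlavzarPetr2018, Ch. 3 §3.1 p. 166 (legal moves between the three pegs)] -/
theorem nodup_movePairs : movePairs.Nodup := by decide

/-- A move goes between two different pegs.
[cite: HinzKlavzarPetr2018, Ch. 3 §3.1 p. 166 (legal moves between the three pegs)] -/
theorem ne_of_mem_movePairs {m : ZMod 3 × ZMod 3} (h : m ∈ movePairs) : m.1 ≠ m.2 := by
  revert m; decide

/-- Counting the reversible arcs out of `σ` BY MOVES («it is customary to identify them with an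
edge»): the arc of the legal move `(p, q)` is half of an edge iff the move `(q, p)` leads back
(`move_eq_of_step_of_step`: no other move can).
[cite: HinzKlavzarPetr2018, Ch. 3 §3.1 p. 166 (arcs identified with an edge; count ours)] -/
theorem length_filter_reversible_eq (σ : IState) (L : List (ZMod 3 × ZMod 3)) :
    ((L.filterMap (step σ)).filter fun τ => decide (σ ∈ succs τ)).length =
      (L.filter fun m =>
        decide (((step σ m).bind fun τ => step τ (m.2, m.1)) = some σ)).length := by
  induction L with
  | nil => rfl
  | cons m L ih =>
    cases h : step σ m with
    | none => simp [h, ih]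
    | some τ =>
      have key : (σ ∈ succs τ) ↔ step τ (m.2, m.1) = some σ := by
        rw [mem_succs]
        constructor
        · rintro ⟨m', hm'⟩
          obtain ⟨p, q⟩ := m
          rwa [move_eq_of_step_of_step h hm'] at hm'
        · exact fun h' => ⟨_, h'⟩
      by_cases hk : step τ (m.2, m.1) = some σ
      · simp [h, ih, key, hk]
      · simp [h, ih, key, hk]

/-- In a nonempty state of `𝔗^n` some top disc moves legally («by a legal move of one disc») to
BOTH other pegs — the smallest top disc (all discs are distinct).
[cite: HinzKlavzarPetr2018, Ch. 3 §3.1 p. 166 (legal moves of one disc; ours)] -/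
theorem exists_peg_twoLegal {n : ℕ} {τ : IState} (hτ : IsState n τ) (hn : n ≠ 0) :
    ∃ r, ∀ q, q ≠ r → (step τ (r, q)).isSome := by
  classical
  have hne : (Finset.univ.filter fun i : ZMod 3 => τ.stack i ≠ []).Nonempty := by
    by_contra h
    rw [Finset.not_nonempty_iff_eq_empty, Finset.filter_eq_empty_iff] at h
    have h0 := h (Finset.mem_univ 0)
    have h1 := h (Finset.mem_univ 1)
    have h2 := h (Finset.mem_univ 2)
    simp only [stack_zero, stack_one, stack_two, ne_eq, not_not] at h0 h1 h2
    have hl := hτ.length_eq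
    simp [IState.discs, h0, h1, h2] at hl
    exact hn hl.symm
  obtain ⟨r, hr, hmin⟩ := Finset.exists_min_image _ (fun i => (τ.stack i).headD 0) hne
  rw [Finset.mem_filter] at hr
  obtain ⟨x, l, hs⟩ := List.exists_cons_of_ne_nil hr.2
  refine ⟨r, fun q hqr => ?_⟩
  have hc : ∀ y ∈ (τ.stack q).head?, x < y := by
    intro y hy
    cases hq : τ.stack q with
    | nil => rw [hq] at hy; simp at hy
    | cons y' l' =>
      rw [hq] at hy
      simp only [List.head?_cons, Option.mem_def, Option.some.injEq] at hy
      have hle : x ≤ y' := by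
        have := hmin q (by rw [Finset.mem_filter]; exact ⟨Finset.mem_univ _, by rw [hq]; simp⟩)
        rw [hs, hq] at this
        simpa using this
      have hxy : x ≠ y' := by
        intro hxy
        apply hqr
        refine (hτ.peg_unique (d := x) (i := r) (j := q) ?_ ?_).symm
        · rw [hs]; exact List.mem_cons_self
        · rw [hq, hxy]; exact List.mem_cons_self
      omega
  rw [step_of_stack (Ne.symm hqr) hs hc]
  rfl

/-- … and only one peg has a top disc that moves legally to both other pegs (of two such top
discs each would be smaller than the other).
[cite: HinzKlavzarPetr2018, Ch. 3 §3.1 p. 166 (legal moves of one disc; ours)] -/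
theorem peg_twoLegal_unique {τ : IState} {r r' : ZMod 3}
    (hr : ∀ q, q ≠ r → (step τ (r, q)).isSome) (hr' : ∀ q, q ≠ r' → (step τ (r', q)).isSome) :
    r = r' := by
  by_contra hne
  obtain ⟨υ, hυ⟩ := Option.isSome_iff_exists.1 (hr r' (Ne.symm hne))
  obtain ⟨υ', hυ'⟩ := Option.isSome_iff_exists.1 (hr' r hne)
  obtain ⟨x, l, hs, hc, -⟩ := step_inv hυ
  obtain ⟨x', l', hs', hc', -⟩ := step_inv hυ'
  simp only at hs hc hs' hc'
  rw [hs'] at hc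
  rw [hs] at hc'
  have h1 := hc x' (by simp)
  have h2 := hc' x (by simp)
  omega

/-- Hence exactly two of the six moves start at the peg whose top disc moves legally to both
other pegs, in every nonempty state of `𝔗^n`.
[cite: HinzKlavzarPetr2018, Ch. 3 §3.1 p. 166 (legal moves of one disc; ours)] -/
theorem length_filter_twoLegal_movePairs {n : ℕ} {τ : IState} (hτ : IsState n τ) (hn : n ≠ 0) :
    (movePairs.filter fun m => decide (∀ q, q ≠ m.1 → (step τ (m.1, q)).isSome)).length = 2 := by
  obtain ⟨r, hr⟩ := exists_peg_twoLegal hτ hn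
  have heq : (movePairs.filter fun m => decide (∀ q, q ≠ m.1 → (step τ (m.1, q)).isSome)) =
      movePairs.filter fun m => decide (m.1 = r) := by
    apply List.filter_congr
    intro m _
    simp only [decide_eq_decide]
    exact ⟨fun h => peg_twoLegal_unique h hr, fun h => h ▸ hr⟩
  rw [heq]
  clear heq hr
  revert r
  decide

/-- PARKING a disc — putting the top disc `x` of peg `p` (rest `l`) onto peg `r`, legal or not —
permutes the discs, so it stays inside `𝔗^n`.
[cite: HinzKlavzarPetr2018, Ch. 3 §3.1 p. 166 (the sets 𝔗^n and T^n; parking ours)] -/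
theorem perm_discs_park {σ : IState} {p r : ZMod 3} {x : ℕ} {l : List ℕ}
    (hs : σ.stack p = x :: l) (hpr : p ≠ r) :
    ((σ.set p l).set r (x :: σ.stack r)).discs.Perm σ.discs := by
  have hσ := discs_perm_stack_rest σ p
  have hτ := discs_perm_stack_rest ((σ.set p l).set r (x :: σ.stack r)) p
  rw [stack_set_of_ne _ hpr, stack_set_self, IState.rest] at hτ
  rw [hs, IState.rest] at hσ
  refine hτ.trans (List.Perm.trans ?_ hσ.symm)
  have h1 : p + 1 ≠ p := by rw [ne_eq, add_eq_left]; decide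
  have h2 : p + 2 ≠ p := by rw [ne_eq, add_eq_left]; decide
  have h12 : p + 1 ≠ p + 2 := by rw [ne_eq, add_right_inj]; decide
  rcases eq_add_of_ne hpr with hq | hq
  · rw [hq, stack_set_self, stack_set_of_ne _ h12.symm, stack_set_of_ne _ h2]
    simp only [List.cons_append]
    exact List.perm_middle
  · rw [hq, stack_set_self, stack_set_of_ne _ h12, stack_set_of_ne _ h1, ← List.append_assoc]
    simp only [List.cons_append]
    exact List.perm_middle.trans (by rw [List.append_assoc])

/-- Parking the top disc of peg `p` on peg `r` and then the top disc of peg `r` back on peg `p`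
restores the state (top discs and rests taken blindly, as in the counting bijection).
[cite: HinzKlavzarPetr2018, Ch. 3 §3.1 p. 166 (the sets 𝔗^n and T^n; parking ours)] -/
theorem unpark_park (σ : IState) {p r : ZMod 3} (hpr : p ≠ r) (hne : σ.stack p ≠ []) :
    (((σ.set p (σ.stack p).tail).set r ((σ.stack p).headD 0 :: σ.stack r)).set r
        (((σ.set p (σ.stack p).tail).set r ((σ.stack p).headD 0 :: σ.stack r)).stack r).tail).set p
      ((((σ.set p (σ.stack p).tail).set r ((σ.stack p).headD 0 :: σ.stack r)).stack r).headD 0 ::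
        ((σ.set p (σ.stack p).tail).set r ((σ.stack p).headD 0 :: σ.stack r)).stack p) = σ := by
  obtain ⟨x, l, hs⟩ := List.exists_cons_of_ne_nil hne
  have htp : ((σ.set p (σ.stack p).tail).set r ((σ.stack p).headD 0 :: σ.stack r)).stack p =
      l := by
    rw [stack_set_of_ne _ hpr, stack_set_self, hs]; rfl
  rw [stack_set_self, htp, hs]
  simp only [List.tail_cons, List.headD_cons]
  refine IState.ext_stack fun i => ?_
  by_cases hip : i = p
  · subst hip; rw [stack_set_self, hs]
  · rw [stack_set_of_ne _ hip]
    by_cases hir : i = r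
    · subst hir; rw [stack_set_self]
    · rw [stack_set_of_ne _ hir, stack_set_of_ne _ hir, stack_set_of_ne _ hip]

/-! ## Edges = states: the bijection -/

/-- FROM A REVERSIBLE ARC TO A STATE: if the move `(p, q)` of the top disc `x` of peg `p` is legal
and the move `(q, p)` leads back, park `x` on the third peg `-(p+q)` instead; the parked state is
in `𝔗^n` and there `x` moves legally to both other pegs.
[cite: HinzKlavzarPetr2018, Ch. 3 §3.1 p. 166 (edges of the mixed graph; bijection ours)] -/
theorem park_of_reversible {n : ℕ} {σ υ : IState} {p q : ZMod 3} (hσ : IsState n σ)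
    (h : step σ (p, q) = some υ) (hrev : step υ (q, p) = some σ) :
    ∃ x l, σ.stack p = x :: l ∧
      IsState n ((σ.set p l).set (-(p + q)) (x :: σ.stack (-(p + q)))) ∧
      ∀ q', q' ≠ -(p + q) →
        (step ((σ.set p l).set (-(p + q)) (x :: σ.stack (-(p + q)))) (-(p + q), q')).isSome := by
  have hpq : p ≠ q := ne_of_step_eq_some h
  obtain ⟨htp, htq⟩ := third_ne hpq
  obtain ⟨x, l, hs, hc, rfl⟩ := step_inv h
  simp only at hs hc
  have hback : ∀ y ∈ l.head?, x < y := (step_reverse_iff hs h).1 hrev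
  refine ⟨x, l, hs, hσ.of_perm (perm_discs_park hs htp.symm), fun q' hq' => ?_⟩
  have hτt : ((σ.set p l).set (-(p + q)) (x :: σ.stack (-(p + q)))).stack (-(p + q)) =
      x :: σ.stack (-(p + q)) := stack_set_self _ _ _
  have hcases : q' = p ∨ q' = q := by
    by_contra hcon
    exact hq' (eq_third hpq (fun h₁ => hcon (Or.inl h₁)) fun h₂ => hcon (Or.inr h₂))
  rcases hcases with rfl | rfl
  · rw [step_of_stack htp hτt (by rw [stack_set_of_ne _ htp.symm, stack_set_self]; exact hback)]
    rfl
  · rw [step_of_stack htq hτt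
      (by rw [stack_set_of_ne _ htq.symm, stack_set_of_ne _ hpq.symm]; exact hc)]
    rfl

/-- FROM A STATE TO A REVERSIBLE ARC: if the top disc `x` of peg `r` moves legally to both other
pegs, move it to the third peg `p = -(r+q)` of `r` and `q ≠ r`; the new state is in `𝔗^n`, and
from it the move `(p, q)` is legal and the move `(q, p)` leads back.
[cite: HinzKlavzarPetr2018, Ch. 3 §3.1 p. 166 (edges of the mixed graph; bijection ours)] -/
theorem reversible_of_twoLegal {n : ℕ} {τ : IState} {r q : ZMod 3} (hτ : IsState n τ)
    (hrq : r ≠ q) (hmin : ∀ q', q' ≠ r → (step τ (r, q')).isSome) :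
    ∃ x l, τ.stack r = x :: l ∧
      IsState n ((τ.set r l).set (-(r + q)) (x :: τ.stack (-(r + q)))) ∧
      ((step ((τ.set r l).set (-(r + q)) (x :: τ.stack (-(r + q)))) (-(r + q), q)).bind
          fun υ => step υ (q, -(r + q))) =
        some ((τ.set r l).set (-(r + q)) (x :: τ.stack (-(r + q)))) := by
  obtain ⟨htr, htq⟩ := third_ne hrq
  obtain ⟨υ₁, h₁⟩ := Option.isSome_iff_exists.1 (hmin (-(r + q)) htr)
  obtain ⟨υ₂, h₂⟩ := Option.isSome_iff_exists.1 (hmin q hrq.symm)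
  obtain ⟨x, l, hs, hcp, rfl⟩ := step_inv h₁
  obtain ⟨x', l', hs', hcq, -⟩ := step_inv h₂
  simp only at hs hcp hs' hcq
  rw [hs] at hs'
  obtain ⟨rfl, rfl⟩ := List.cons.inj hs'
  refine ⟨x, l, hs, hτ.of_perm (perm_discs_of_step h₁), ?_⟩
  have hσp : ((τ.set r l).set (-(r + q)) (x :: τ.stack (-(r + q)))).stack (-(r + q)) =
      x :: τ.stack (-(r + q)) := stack_set_self _ _ _
  have hσq : ((τ.set r l).set (-(r + q)) (x :: τ.stack (-(r + q)))).stack q = τ.stack q := by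
    rw [stack_set_of_ne _ htq.symm, stack_set_of_ne _ hrq.symm]
  have hstep := step_of_stack htq hσp (by rw [hσq]; exact hcq)
  rw [Option.bind_eq_some_iff]
  exact ⟨_, hstep, (step_reverse_iff hσp hstep).2 hcp⟩

/-! ## Edges = states: the counts -/

/-- EDGES = STATES: the reversible arcs of `\vec H_3^n` (the `τ ∈ succs σ` with `σ ∈ succs τ`,
each edge counted from both ends), `n ≠ 0`, number `2·|𝔗^n|` — the mixed graph has exactly as
many edges («it is customary to identify them with an edge») as vertices (Figure 3.2: 12 and
60). Proof: the parking bijection between reversible arcs and (state, one of the two moves of its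
smallest top disc).
[cite: HinzKlavzarPetr2018, Ch. 3 §3.1 pp. 166–167 (edges of \vec H_3^n; Figure 3.2; ours)] -/
theorem sum_length_filter_reversible_allStates {n : ℕ} (hn : n ≠ 0) :
    ((allStates n).map fun σ => ((succs σ).filter fun τ => decide (σ ∈ succs τ)).length).sum =
      2 * (allStates n).length := by
  classical
  have h1 : ((allStates n).map fun σ => ((succs σ).filter fun τ => decide (σ ∈ succs τ)).length)
      = (allStates n).map fun σ => (movePairs.filter fun m =>
        decide (((step σ m).bind fun τ => step τ (m.2, m.1)) = some σ)).length :=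
    List.map_congr_left fun σ _ => length_filter_reversible_eq σ movePairs
  rw [h1]
  have cnt : ∀ (P : ZMod 3 × ZMod 3 → Prop) [DecidablePred P],
      (movePairs.filter fun x => decide (P x)).length =
        ∑ x ∈ movePairs.toFinset, if P x then 1 else 0 := by
    intro P _
    rw [← List.toFinset_card_of_nodup (nodup_movePairs.filter _), ← Finset.card_filter]
    congr 1
    ext x
    simp
  have hL : ((allStates n).map fun σ => (movePairs.filter fun m =>
        decide (((step σ m).bind fun τ => step τ (m.2, m.1)) = some σ)).length).sum =
      (((allStates n).toFinset ×ˢ movePairs.toFinset).filter fun a : IState × (ZMod 3 × ZMod 3) =>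
        ((step a.1 a.2).bind fun τ => step τ (a.2.2, a.2.1)) = some a.1).card := by
    rw [Finset.card_filter, Finset.sum_product, ← List.sum_toFinset _ (nodup_allStates n)]
    refine Finset.sum_congr rfl fun σ _ => ?_
    rw [cnt]
  have hR : (((allStates n).toFinset ×ˢ movePairs.toFinset).filter
      fun b : IState × (ZMod 3 × ZMod 3) =>
        ∀ q', q' ≠ b.2.1 → (step b.1 (b.2.1, q')).isSome).card = 2 * (allStates n).length := by
    rw [Finset.card_filter, Finset.sum_product, ← List.toFinset_card_of_nodup (nodup_allStates n),
      Finset.card_eq_sum_ones, Finset.mul_sum]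
    refine Finset.sum_congr rfl fun τ hτ => ?_
    rw [List.mem_toFinset, mem_allStates] at hτ
    have h2 := length_filter_twoLegal_movePairs hτ hn
    rw [cnt] at h2
    rw [mul_one]
    exact h2
  rw [hL, ← hR]
  apply Finset.card_nbij'
    (fun a : IState × (ZMod 3 × ZMod 3) =>
      ((a.1.set a.2.1 (a.1.stack a.2.1).tail).set (-(a.2.1 + a.2.2))
        (((a.1.stack a.2.1).headD 0) :: a.1.stack (-(a.2.1 + a.2.2))), (-(a.2.1 + a.2.2), a.2.2)))
    (fun a : IState × (ZMod 3 × ZMod 3) =>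
      ((a.1.set a.2.1 (a.1.stack a.2.1).tail).set (-(a.2.1 + a.2.2))
        (((a.1.stack a.2.1).headD 0) :: a.1.stack (-(a.2.1 + a.2.2))), (-(a.2.1 + a.2.2), a.2.2)))
  · rintro ⟨σ, p, q⟩ ha
    simp only [Finset.mem_coe, Finset.mem_filter, Finset.mem_product, List.mem_toFinset,
      mem_allStates] at ha ⊢
    obtain ⟨⟨hσ, -⟩, hrev⟩ := ha
    obtain ⟨υ, h, hback⟩ := Option.bind_eq_some_iff.1 hrev
    obtain ⟨x, l, hs, hst, hmin⟩ := park_of_reversible hσ h hback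
    simp only [hs, List.tail_cons, List.headD_cons]
    exact ⟨⟨hst, mem_movePairs (third_ne (ne_of_step_eq_some h)).2⟩, hmin⟩
  · rintro ⟨τ, r, q⟩ hb
    simp only [Finset.mem_coe, Finset.mem_filter, Finset.mem_product, List.mem_toFinset,
      mem_allStates] at hb ⊢
    obtain ⟨⟨hτ, hm⟩, hmin⟩ := hb
    have hrq : r ≠ q := ne_of_mem_movePairs hm
    obtain ⟨x, l, hs, hst, hrev⟩ := reversible_of_twoLegal hτ hrq hmin
    simp only [hs, List.tail_cons, List.headD_cons]
    exact ⟨⟨hst, mem_movePairs (third_ne hrq).2⟩, hrev⟩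
  · rintro ⟨σ, p, q⟩ ha
    simp only [Finset.mem_coe, Finset.mem_filter, Finset.mem_product, List.mem_toFinset,
      mem_allStates] at ha
    obtain ⟨⟨-, -⟩, hrev⟩ := ha
    obtain ⟨υ, h, -⟩ := Option.bind_eq_some_iff.1 hrev
    have hpq : p ≠ q := ne_of_step_eq_some h
    obtain ⟨x, l, hs, -, -⟩ := step_inv h
    simp only at hs
    have e : -(-(p + q) + q) = p := by ring
    simp only [e]
    rw [unpark_park σ (third_ne hpq).1.symm (by rw [hs]; exact List.cons_ne_nil x l)]
  · rintro ⟨τ, r, q⟩ hb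
    simp only [Finset.mem_coe, Finset.mem_filter, Finset.mem_product, List.mem_toFinset,
      mem_allStates] at hb
    obtain ⟨⟨-, hm⟩, hmin⟩ := hb
    have hrq : r ≠ q := ne_of_mem_movePairs hm
    obtain ⟨υ, h⟩ := Option.isSome_iff_exists.1 (hmin q hrq.symm)
    obtain ⟨x, l, hs, -, -⟩ := step_inv h
    simp only at hs
    have e : -(-(r + q) + q) = r := by ring
    simp only [e]
    rw [unpark_park τ (third_ne hrq).1.symm (by rw [hs]; exact List.cons_ne_nil x l)]

/-- EDGES = STATES in closed form: `(n+2)!` reversible arcs in `\vec H_3^n`, `n ≠ 0`, i.e.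
`(n+2)!/2 = |𝔗^n|` edges (24, 120, 720 reversible arcs for `n = 2, 3, 4`).
[cite: HinzKlavzarPetr2018, Ch. 3 §3.1 pp. 166–167 (Prop. 3.1; Figure 3.2; count ours)] -/
theorem sum_length_filter_reversible_allStates_eq_factorial {n : ℕ} (hn : n ≠ 0) :
    ((allStates n).map fun σ => ((succs σ).filter fun τ => decide (σ ∈ succs τ)).length).sum =
      (n + 2).factorial := by
  rw [sum_length_filter_reversible_allStates hn, length_allStates]
  exact Nat.mul_div_cancel' (Nat.dvd_factorial (by omega) (by omega))

/-- ONE-WAY ARCS («some of the edges must be oriented»): the arcs of `\vec H_3^n`, `n ≠ 0`, that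
are not halves of edges number `|𝔗^n| − 3·n!`: `Σ + 3·n! = |𝔗^n|`.
[cite: HinzKlavzarPetr2018, Ch. 3 §3.1 pp. 166–167 (oriented arcs; Figure 3.2; count ours)] -/
theorem sum_length_filter_oneWay_allStates_add {n : ℕ} (hn : n ≠ 0) :
    ((allStates n).map fun σ => ((succs σ).filter fun τ => decide (σ ∉ succs τ)).length).sum +
      3 * Nat.factorial n = (allStates n).length := by
  have hsplit : ((allStates n).map fun σ => (succs σ).length) =
      (allStates n).map fun σ => ((succs σ).filter fun τ => decide (σ ∉ succs τ)).length +
        ((succs σ).filter fun τ => decide (σ ∈ succs τ)).length := by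
    refine List.map_congr_left fun σ _ => ?_
    rw [List.length_eq_length_filter_add (fun τ => decide (σ ∈ succs τ)), Nat.add_comm]
    congr 2
    exact List.filter_congr fun τ _ => by simp
  have h1 := sum_length_succs_allStates_add hn
  have h2 := sum_length_filter_reversible_allStates hn
  rw [hsplit, List.sum_map_add] at h1
  omega

/-- ONE-WAY ARCS in closed form: `(n+2)!/2 − 3·n!` (6, 42, 288 for `n = 2, 3, 4`).
[cite: HinzKlavzarPetr2018, Ch. 3 §3.1 pp. 166–167 (oriented arcs; Figure 3.2; count ours)] -/
theorem sum_length_filter_oneWay_allStates {n : ℕ} (hn : n ≠ 0) :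
    ((allStates n).map fun σ => ((succs σ).filter fun τ => decide (σ ∉ succs τ)).length).sum =
      (n + 2).factorial / 2 - 3 * Nat.factorial n := by
  have h := sum_length_filter_oneWay_allStates_add hn
  rw [length_allStates] at h
  omega

end IrregularMixedGraphCounts

end Literature.Combinatorics.Hinz2018
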